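import Summits.QuantumAdvantage.QuantumAdvantage.Theorems.WbwVerifiableLineNoSpeedup.Negative.AdversaryCounts
import Summits.QuantumAdvantage.QuantumAdvantage.Theorems.WbwVerifiableLineNoSpeedup.Negative.WeightedAdversaryBound

/-!
# The adversary lower bound for black-box SVL: `κ · min(T, √(2^m)) ≤ Q_{1/3}(SVL_{m,T})` for `8T ≤ 2^m`

Final file of the `Adversary*` sequence supporting the crux `WhiteBoxWalk.WbwVerifiableLineNoSpeedup`
(stmt-QuantumAdvantage-2239; refuter work file `Cruxes/WbwVerifiableLineNoSpeedup/Disproof.lean` §7).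
The two counts of Ambainis's datum packaged for all admissible `(m, T)` (`degrees`, `products`),
and the bound `svlAdversarySmallT` obtained by feeding the `permInput`-images of `Xp, Yp, Rp` to
`WeightedAdversary.weightedAdversaryBound_holds` (`m₀ = m₁ = T(2^m/2 - 2T - 1) ≥ T·2^m/8`,
`ℓ = max((2^m+T)², 2T²2^m)`, so `√(m₀²/ℓ) ≥ min(T, √(2^m))/12`). With padding monotonicity
(`Padding.lean`) and the checked reduction in the work file, this proves the crux. Sorry-free.
-/

noncomputable section

set_option linter.dupNamespace false

namespace Summit.QuantumAdvantage.QuantumAdvantage.Theorems.WbwVerifiableLineNoSpeedup.Negative.Adversary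

open Finset Literature.Computability.Cryptography Literature.Computability.QuantumComplexity
  Literature.Computability.Complexity
open Summit.QuantumAdvantage.QuantumAdvantage.Theorems.WbwVerifiableLineNoSpeedup.Negative.PermInstances
open Summit.QuantumAdvantage.QuantumAdvantage.Theorems.WbwVerifiableLineNoSpeedup.Negative

variable {m T : ℕ}

/-- Reading an S-bit of a permutation instance. [folklore] -/
theorem permInput_castAdd (ρ : Equiv.Perm (Fin (2 ^ m))) (a : Fin (2 ^ m)) (β : Fin m) :
    permInput T ρ (Fin.castAdd _ (finProdFinEquiv (a, β))) = (ρ a).val.testBit β.val := by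
  show svlSuccBit (permInput T ρ) a β = _
  rw [permInput, svlSuccBit_svlInput]

/-- Reading a V-bit of a permutation instance. [folklore] -/
theorem permInput_natAdd (ρ : Equiv.Perm (Fin (2 ^ m))) (x : Fin (2 ^ m)) (i : Fin (T + 1)) :
    permInput T ρ (Fin.natAdd _ (finProdFinEquiv (x, i))) = decide (x = (ρ ^ i.val) (src0 m)) := by
  show svlVerify (permInput T ρ) x i = _
  rw [permInput, svlVerify_svlInput]
  rfl

/-- `8T ≤ 2^m` with `T ≥ 1` forces `m ≥ 1`. [folklore] -/
theorem one_le_m_of (hT : 1 ≤ T) (h8 : 8 * T ≤ 2 ^ m) : 1 ≤ m := by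
  by_contra h
  push Not at h
  interval_cases m
  simp at h8
  omega


/-- **The degree count** of the datum: every member of either side has at least
`T (2^m/2 - 2T - 1)` partners (`8T ≤ 2^m`). [folklore] -/
theorem degrees (m T : ℕ) (hT : 1 ≤ T) (h8 : 8 * T ≤ 2 ^ m) :
    (∀ σ ∈ Xp m T, (T : ℝ) * ((2 : ℝ) ^ m / 2 - 2 * T - 1) ≤ #((Rp m T).filter fun p => p.1 = σ)) ∧
    (∀ σ' ∈ Yp m T, (T : ℝ) * ((2 : ℝ) ^ m / 2 - 2 * T - 1) ≤ #((Rp m T).filter fun p => p.2 = σ')) := by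
  classical
  have hm := one_le_m_of hT h8
  exact ⟨fun σ hσ => degree_fst hm hσ, fun σ' hσ' => degree_snd hm hσ'⟩

/-- **The product count** of the datum: for a related pair and a bit of the table where the two
inputs differ, (#partners of the left end differing from it there) × (#partners of the right end
differing from it there) `≤ max((2^m+T)², 2T²·2^m)` (S-bits: row counts; V-bits: total count ×
acquire count). [folklore] -/
theorem products (m T : ℕ) :
    ∀ p ∈ Rp m T, ∀ z : Fin (2 ^ m * m + 2 ^ m * (T + 1)),
      permInput T p.1 z ≠ permInput T p.2 z →
      (#((Rp m T).filter fun q => q.1 = p.1 ∧ permInput T q.2 z ≠ permInput T p.1 z) : ℝ) *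
        #((Rp m T).filter fun q => q.2 = p.2 ∧ permInput T q.1 z ≠ permInput T p.2 z) ≤
      max (((2 : ℝ) ^ m + T) ^ 2) (2 * (T : ℝ) ^ 2 * 2 ^ m) := by
  classical
  intro p hp z hz
  rw [mem_Rp_iff] at hp
  obtain ⟨hX, hY, hadj⟩ := hp
  have hσ := noReturn_of_mem_Xp hX
  have hσ' := noReturn_of_mem_Yp hY
  have hNT : ((2 : ℝ) ^ m + T) ^ 2 ≤ max (((2 : ℝ) ^ m + T) ^ 2) (2 * (T : ℝ) ^ 2 * 2 ^ m) :=
    le_max_left _ _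
  have hTN : (T : ℝ) * 2 ^ m * T ≤ max (((2 : ℝ) ^ m + T) ^ 2) (2 * (T : ℝ) ^ 2 * 2 ^ m) := by
    refine le_trans ?_ (le_max_right _ _)
    nlinarith [pow_pos (by norm_num : (0:ℝ) < 2) m, sq_nonneg (T : ℝ)]
  induction z using Fin.addCases with
  | left k' =>
    -- an S-bit: row `a`, bit `β`
    obtain ⟨⟨a, β⟩, rfl⟩ : ∃ ab : Fin (2 ^ m) × Fin m, finProdFinEquiv ab = k' :=
      ⟨finProdFinEquiv.symm k', Equiv.apply_symm_apply _ _⟩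
    have h1 : #((Rp m T).filter fun q => q.1 = p.1 ∧
        permInput T q.2 (Fin.castAdd _ (finProdFinEquiv (a, β))) ≠
          permInput T p.1 (Fin.castAdd _ (finProdFinEquiv (a, β)))) ≤ 2 ^ m + T := by
      refine le_trans (Finset.card_le_card fun q hq => ?_) (card_partners_fst_row_le hσ.atZero a)
      rw [Finset.mem_filter] at hq ⊢
      refine ⟨hq.1, hq.2.1, fun heq => hq.2.2 ?_⟩
      rw [permInput_castAdd, permInput_castAdd, heq]
    have h2 : #((Rp m T).filter fun q => q.2 = p.2 ∧
        permInput T q.1 (Fin.castAdd _ (finProdFinEquiv (a, β))) ≠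
          permInput T p.2 (Fin.castAdd _ (finProdFinEquiv (a, β)))) ≤ 2 ^ m + T := by
      refine le_trans (Finset.card_le_card fun q hq => ?_) (card_partners_snd_row_le hσ'.atZero a)
      rw [Finset.mem_filter] at hq ⊢
      refine ⟨hq.1, hq.2.1, fun heq => hq.2.2 ?_⟩
      rw [permInput_castAdd, permInput_castAdd, heq]
    have h1' : (#((Rp m T).filter fun q => q.1 = p.1 ∧
        permInput T q.2 (Fin.castAdd _ (finProdFinEquiv (a, β))) ≠
          permInput T p.1 (Fin.castAdd _ (finProdFinEquiv (a, β)))) : ℝ) ≤ 2 ^ m + T := by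
      exact_mod_cast h1
    have h2' : (#((Rp m T).filter fun q => q.2 = p.2 ∧
        permInput T q.1 (Fin.castAdd _ (finProdFinEquiv (a, β))) ≠
          permInput T p.2 (Fin.castAdd _ (finProdFinEquiv (a, β)))) : ℝ) ≤ 2 ^ m + T := by
      exact_mod_cast h2
    refine le_trans ?_ hNT
    rw [sq]
    exact mul_le_mul h1' h2' (by positivity) (by positivity)
  | right k' =>
    obtain ⟨⟨x, i⟩, rfl⟩ : ∃ xi : Fin (2 ^ m) × Fin (T + 1), finProdFinEquiv xi = k' :=
      ⟨finProdFinEquiv.symm k', Equiv.apply_symm_apply _ _⟩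
    rw [permInput_natAdd, permInput_natAdd] at hz
    by_cases hxi : x = (p.1 ^ i.val) (src0 m)
    · -- left end has x at i: its factor is bounded by all partners; right end acquires
      have hxi' : (p.2 ^ i.val) (src0 m) ≠ x := by
        intro h; apply hz; rw [decide_eq_true hxi, decide_eq_true h.symm]
      have h1 : #((Rp m T).filter fun q => q.1 = p.1 ∧
          permInput T q.2 (Fin.natAdd _ (finProdFinEquiv (x, i))) ≠
            permInput T p.1 (Fin.natAdd _ (finProdFinEquiv (x, i)))) ≤ T * 2 ^ m :=
        le_trans (Finset.card_le_card (Finset.monotone_filter_right _ fun q _ hq => hq.1))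
          (card_partners_fst_le p.1)
      have h2 : #((Rp m T).filter fun q => q.2 = p.2 ∧
          permInput T q.1 (Fin.natAdd _ (finProdFinEquiv (x, i))) ≠
            permInput T p.2 (Fin.natAdd _ (finProdFinEquiv (x, i)))) ≤ T := by
        refine le_trans (Finset.card_le_card fun q hq => ?_) (card_partners_snd_acquire_le hσ' x i hxi')
        rw [Finset.mem_filter] at hq ⊢
        refine ⟨hq.1, hq.2.1, ?_⟩
        have h := hq.2.2
        rw [permInput_natAdd, permInput_natAdd] at h
        have hf : decide (x = (p.2 ^ i.val) (src0 m)) = false :=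
          decide_eq_false (fun h' => hxi' h'.symm)
        rw [hf] at h
        have ht : x = (q.1 ^ i.val) (src0 m) := by
          by_contra hne
          exact h (decide_eq_false hne)
        exact ht.symm
      have h1' : (#((Rp m T).filter fun q => q.1 = p.1 ∧
          permInput T q.2 (Fin.natAdd _ (finProdFinEquiv (x, i))) ≠
            permInput T p.1 (Fin.natAdd _ (finProdFinEquiv (x, i)))) : ℝ) ≤ T * 2 ^ m := by
        exact_mod_cast h1
      have h2' : (#((Rp m T).filter fun q => q.2 = p.2 ∧
          permInput T q.1 (Fin.natAdd _ (finProdFinEquiv (x, i))) ≠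
            permInput T p.2 (Fin.natAdd _ (finProdFinEquiv (x, i)))) : ℝ) ≤ T := by
        exact_mod_cast h2
      refine le_trans ?_ hTN
      exact mul_le_mul h1' h2' (by positivity) (by positivity)
    · -- left end acquires; right end bounded by all partners
      have h1 : #((Rp m T).filter fun q => q.1 = p.1 ∧
          permInput T q.2 (Fin.natAdd _ (finProdFinEquiv (x, i))) ≠
            permInput T p.1 (Fin.natAdd _ (finProdFinEquiv (x, i)))) ≤ T := by
        refine le_trans (Finset.card_le_card fun q hq => ?_)
          (card_partners_fst_acquire_le hσ x i (fun h' => hxi h'.symm))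
        rw [Finset.mem_filter] at hq ⊢
        refine ⟨hq.1, hq.2.1, ?_⟩
        have h := hq.2.2
        rw [permInput_natAdd, permInput_natAdd] at h
        have hf : decide (x = (p.1 ^ i.val) (src0 m)) = false := decide_eq_false hxi
        rw [hf] at h
        have ht : x = (q.2 ^ i.val) (src0 m) := by
          by_contra hne
          exact h (decide_eq_false hne)
        exact ht.symm
      have h2 : #((Rp m T).filter fun q => q.2 = p.2 ∧
          permInput T q.1 (Fin.natAdd _ (finProdFinEquiv (x, i))) ≠
            permInput T p.2 (Fin.natAdd _ (finProdFinEquiv (x, i)))) ≤ T * 2 ^ m :=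
        le_trans (Finset.card_le_card (Finset.monotone_filter_right _ fun q _ hq => hq.1))
          (card_partners_snd_le p.2)
      have h1' : (#((Rp m T).filter fun q => q.1 = p.1 ∧
          permInput T q.2 (Fin.natAdd _ (finProdFinEquiv (x, i))) ≠
            permInput T p.1 (Fin.natAdd _ (finProdFinEquiv (x, i)))) : ℝ) ≤ T := by
        exact_mod_cast h1
      have h2' : (#((Rp m T).filter fun q => q.2 = p.2 ∧
          permInput T q.1 (Fin.natAdd _ (finProdFinEquiv (x, i))) ≠
            permInput T p.2 (Fin.natAdd _ (finProdFinEquiv (x, i)))) : ℝ) ≤ T * 2 ^ m := by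
        exact_mod_cast h2
      refine le_trans ?_ hTN
      calc _ ≤ (T : ℝ) * (T * 2 ^ m) := mul_le_mul h1' h2' (by positivity) (by positivity)
        _ = T * 2 ^ m * T := by ring

/-- **THE ADVERSARY LOWER BOUND FOR BLACK-BOX SVL** (Target A of the crux work file, now a
theorem): there is an absolute `κ > 0` (`κ = 1/(144·12)`) with
`κ · min(T, √(2^m)) ≤ Q_{1/3}(svlPromise m T, svlSinkBit m T)` whenever `1 ≤ T` and `8T ≤ 2^m`
— Ambainis's weighted relational adversary bound (`WeightedAdversary.weightedAdversaryBound_holds`)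
on the datum of `AdversaryDatum.lean`, with the counts `degrees` and `products`. Together with
`SvlPadding.quantumQueryComplexityOn_svl_pad` and the reduction `crux_of_smallT` of the work file
this PROVES the crux `WhiteBoxWalk.WbwVerifiableLineNoSpeedup` (a prover assembles the one line).
[cite: Ambainis2000, Thm. 6] -/
theorem svlAdversarySmallT :
    ∃ κ : ℝ, 0 < κ ∧ ∀ m T : ℕ, 1 ≤ T → 8 * T ≤ 2 ^ m →
      κ * min (T : ℝ) (Real.sqrt (2 ^ m)) ≤
        (quantumQueryComplexityOn (1 / 3) (svlPromise m T) (svlSinkBit m T) : ℝ) := by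
  classical
  obtain ⟨κ, hκ, hW⟩ := WeightedAdversary.weightedAdversaryBound_holds
  refine ⟨κ / 12, by positivity, fun m T hT h8 => ?_⟩
  -- parameters
  set Nr : ℝ := (2 : ℝ) ^ m with hNr
  have hN8 : (8 : ℝ) * T ≤ Nr := by rw [hNr]; exact_mod_cast h8
  have hT1 : (1 : ℝ) ≤ T := by exact_mod_cast hT
  have hNge8 : (8 : ℝ) ≤ Nr := by nlinarith
  set m₀ : ℝ := (T : ℝ) * (Nr / 2 - 2 * T - 1) with hm₀
  set ℓ : ℝ := max ((Nr + T) ^ 2) (2 * (T : ℝ) ^ 2 * Nr) with hℓ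
  have hm₀pos : 0 < m₀ := by
    rw [hm₀]; apply mul_pos (by linarith); nlinarith
  have hℓpos : 0 < ℓ := lt_of_lt_of_le (by positivity) (le_max_left _ _)
  -- the sides and the relation at input level
  set X : Finset (SVLInput m T) := (Xp m T).image (permInput T) with hX
  set Y : Finset (SVLInput m T) := (Yp m T).image (permInput T) with hY
  set R : Finset (SVLInput m T × SVLInput m T) :=
    (Rp m T).image (Prod.map (permInput T) (permInput T)) with hR
  obtain ⟨hdegX, hdegY⟩ := degrees m T hT h8
  have hprod := products m T
  -- R nonempty: the cyclic shift is in LC; it lies in Xp or Yp, and has ≥ m₀ > 0 partners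
  have hTN : T < 2 ^ m := by omega
  have hRne : R.Nonempty := by
    rw [hR, Finset.image_nonempty]
    have hs := shift_mem_LC (m := m) hTN
    by_cases hpar : sinkParity T (shift m) = 0
    · have hx : shift m ∈ Xp m T := by unfold Xp; rw [Finset.mem_filter]; exact ⟨hs, hpar⟩
      have h := hdegX _ hx
      have hpos : (0 : ℝ) < #((Rp m T).filter fun p => p.1 = shift m) := lt_of_lt_of_le hm₀pos h
      have hpos' : 0 < #((Rp m T).filter fun p => p.1 = shift m) := by exact_mod_cast hpos
      obtain ⟨p, hp⟩ := Finset.card_pos.1 hpos'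
      exact ⟨p, (Finset.mem_filter.1 hp).1⟩
    · have hy : shift m ∈ Yp m T := by
        unfold Yp; rw [Finset.mem_filter]; refine ⟨hs, ?_⟩
        unfold sinkParity at hpar ⊢; omega
      have h := hdegY _ hy
      have hpos : (0 : ℝ) < #((Rp m T).filter fun p => p.2 = shift m) := lt_of_lt_of_le hm₀pos h
      have hpos' : 0 < #((Rp m T).filter fun p => p.2 = shift m) := by exact_mod_cast hpos
      obtain ⟨p, hp⟩ := Finset.card_pos.1 hpos'
      exact ⟨p, (Finset.mem_filter.1 hp).1⟩
  -- apply the weighted adversary bound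
  have hmain := hW _ (svlPromise m T) (svlSinkBit m T) X Y R m₀ m₀ ℓ hm₀pos hm₀pos hℓpos hRne
    (by
      intro t ht
      rw [Finset.mem_coe, hX, Finset.mem_image] at ht
      obtain ⟨σ, hσ, rfl⟩ := ht
      exact mem_promise_of_mem_Xp hσ)
    (by
      intro t ht
      rw [Finset.mem_coe, hY, Finset.mem_image] at ht
      obtain ⟨σ, hσ, rfl⟩ := ht
      exact mem_promise_of_mem_Yp hσ)
    (by
      intro t ht
      rw [hX, Finset.mem_image] at ht
      obtain ⟨σ, hσ, rfl⟩ := ht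
      exact svlSinkBit_of_mem_Xp hσ)
    (by
      intro t ht
      rw [hY, Finset.mem_image] at ht
      obtain ⟨σ, hσ, rfl⟩ := ht
      exact svlSinkBit_of_mem_Yp hσ)
    (by
      intro p hp
      rw [hR, Finset.mem_image] at hp
      obtain ⟨q, hq, rfl⟩ := hp
      unfold Rp at hq
      rw [Finset.mem_filter, Finset.mem_product] at hq
      exact ⟨Finset.mem_image_of_mem _ hq.1.1, Finset.mem_image_of_mem _ hq.1.2⟩)
    (by
      intro t ht
      rw [hX, Finset.mem_image] at ht
      obtain ⟨σ, hσ, rfl⟩ := ht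
      rw [hR, card_filter_image_fst (Rp m T) (fun q => q.1 = σ) (fun p => p.1 = permInput T σ)
        (fun q => by simp [Prod.map, permInput_injective.eq_iff])]
      exact hdegX σ hσ)
    (by
      intro t ht
      rw [hY, Finset.mem_image] at ht
      obtain ⟨σ, hσ, rfl⟩ := ht
      rw [hR, card_filter_image_fst (Rp m T) (fun q => q.2 = σ) (fun p => p.2 = permInput T σ)
        (fun q => by simp [Prod.map, permInput_injective.eq_iff])]
      exact hdegY σ hσ)
    (by
      intro p hp i hi
      rw [hR, Finset.mem_image] at hp
      obtain ⟨q, hq, rfl⟩ := hp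
      simp only [Prod.map_fst, Prod.map_snd] at hi ⊢
      rw [card_filter_image_fst (Rp m T) (fun q' => q'.1 = q.1 ∧ permInput T q'.2 i ≠ permInput T q.1 i)
          (fun p' => p'.1 = permInput T q.1 ∧ p'.2 i ≠ permInput T q.1 i)
          (fun q' => by simp [Prod.map, permInput_injective.eq_iff]),
        card_filter_image_fst (Rp m T) (fun q' => q'.2 = q.2 ∧ permInput T q'.1 i ≠ permInput T q.2 i)
          (fun p' => p'.2 = permInput T q.2 ∧ p'.1 i ≠ permInput T q.2 i)
          (fun q' => by simp [Prod.map, permInput_injective.eq_iff])]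
      exact hprod q hq i hi)
  -- arithmetic: κ √(m₀²/ℓ) ≥ (κ/12) min(T, √N)
  have hsq : Real.sqrt (m₀ * m₀ / ℓ) = m₀ / Real.sqrt ℓ := by
    rw [Real.sqrt_div' _ hℓpos.le, Real.sqrt_mul_self hm₀pos.le]
  rw [hsq] at hmain
  have hsℓ : 0 < Real.sqrt ℓ := Real.sqrt_pos.2 hℓpos
  -- m₀ ≥ T N / 8
  have hm₀ge : (T : ℝ) * Nr / 8 ≤ m₀ := by
    rw [hm₀]
    have : Nr / 8 ≤ Nr / 2 - 2 * T - 1 := by nlinarith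
    nlinarith
  -- √ℓ ≤ max (9N/8) (T √(2N)), handled as two cases
  have hsN : 0 < Real.sqrt Nr := Real.sqrt_pos.2 (by positivity)
  have hkey : min (T : ℝ) (Real.sqrt Nr) / 12 ≤ m₀ / Real.sqrt ℓ := by
    rw [div_le_div_iff₀ (by norm_num) hsℓ]
    -- min · √ℓ ≤ 12 m₀
    rcases le_total ((Nr + T) ^ 2) (2 * (T : ℝ) ^ 2 * Nr) with hcase | hcase
    · -- ℓ = 2 T² N, √ℓ = T √(2N) = T √2 √N
      have hℓeq : ℓ = 2 * (T : ℝ) ^ 2 * Nr := by rw [hℓ]; exact max_eq_right hcase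
      have hsqrtℓ : Real.sqrt ℓ = T * (Real.sqrt 2 * Real.sqrt Nr) := by
        rw [hℓeq, show 2 * (T : ℝ) ^ 2 * Nr = (T : ℝ) ^ 2 * (2 * Nr) by ring,
          Real.sqrt_mul (by positivity), Real.sqrt_sq (by positivity), Real.sqrt_mul (by norm_num)]
      rw [hsqrtℓ]
      have h2 : Real.sqrt 2 ≤ 1.5 := by
        rw [show (1.5 : ℝ) = Real.sqrt (1.5 ^ 2) from (Real.sqrt_sq (by norm_num)).symm]
        exact Real.sqrt_le_sqrt (by norm_num)
      have hmin : min (T : ℝ) (Real.sqrt Nr) ≤ Real.sqrt Nr := min_le_right _ _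
      have hNN : Real.sqrt Nr * Real.sqrt Nr = Nr := Real.mul_self_sqrt (by positivity)
      have h0 : 0 ≤ min (T : ℝ) (Real.sqrt Nr) := le_min (by positivity) hsN.le
      calc min (T : ℝ) (Real.sqrt Nr) * (T * (Real.sqrt 2 * Real.sqrt Nr))
          ≤ Real.sqrt Nr * (T * (1.5 * Real.sqrt Nr)) := by
            apply mul_le_mul hmin _ (by positivity) hsN.le
            apply mul_le_mul_of_nonneg_left _ (by positivity)
            exact mul_le_mul_of_nonneg_right h2 hsN.le
        _ = 1.5 * (T * Nr) := by
            rw [show Real.sqrt Nr * (T * (1.5 * Real.sqrt Nr)) =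
              1.5 * (T * (Real.sqrt Nr * Real.sqrt Nr)) by ring, hNN]
        _ ≤ 12 * m₀ := by nlinarith
        _ = m₀ * 12 := by ring
    · -- ℓ = (N+T)², √ℓ = N + T ≤ 9N/8
      have hℓeq : ℓ = (Nr + T) ^ 2 := by rw [hℓ]; exact max_eq_left hcase
      have hsqrtℓ : Real.sqrt ℓ = Nr + T := by rw [hℓeq]; exact Real.sqrt_sq (by positivity)
      rw [hsqrtℓ]
      have hmin : min (T : ℝ) (Real.sqrt Nr) ≤ T := min_le_left _ _
      have h0 : 0 ≤ min (T : ℝ) (Real.sqrt Nr) := le_min (by positivity) hsN.le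
      calc min (T : ℝ) (Real.sqrt Nr) * (Nr + T) ≤ T * (Nr + T) :=
            mul_le_mul_of_nonneg_right hmin (by positivity)
        _ ≤ T * (Nr + Nr / 8) := by apply mul_le_mul_of_nonneg_left _ (by positivity); linarith
        _ = 9 * (T * Nr / 8) := by ring
        _ ≤ 12 * m₀ := by nlinarith
        _ = m₀ * 12 := by ring
  calc κ / 12 * min (T : ℝ) (Real.sqrt (2 ^ m)) = κ * (min (T : ℝ) (Real.sqrt Nr) / 12) := by
        rw [hNr]; ring
    _ ≤ κ * (m₀ / Real.sqrt ℓ) := mul_le_mul_of_nonneg_left hkey hκ.le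
    _ ≤ _ := hmain

end Summit.QuantumAdvantage.QuantumAdvantage.Theorems.WbwVerifiableLineNoSpeedup.Negative.Adversary
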